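import Literature.Analysis.FluidPDE.KNSSNoAxisymmetricTypeIHolds
import Literature.Analysis.FluidPDE.SereginZajaczkowski2007
import Literature.Analysis.FluidPDE.LocalTypeI
import Literature.Analysis.FluidPDE.SuitableWeakPressure
import Literature.Analysis.FluidPDE.ClassicalSuitable
import Literature.Analysis.Calculus.MixedPartialBound
import HarnessLib

/-!
# Route FrozenSignCascade · crux `BoundedEnvelopeContinuation` — stub AX1s:
# the single-shell sup bound for classical axisymmetric solutions

Helper file for the crux item stmt-NavierStokesRegularity-10579 (`BoundedEnvelopeContinuation`,
conjunct (B) of route `FrozenSignCascade`); lands `--supports` that item (stub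
`shellSupBound_of_abScaledSum`, AX1s of the axisymmetric support skeleton).

Seregin–Zajaczkowski 2007, Prop. 4.1 is the PROVED fact
`SereginZajaczkowski2007.OffAxisSupBound_holds`: for every pair `(V, P)` of the class
`IsSmoothAxisymmetricSolutionOn Q̃ V P` on the shell `Q̃ = 𝒞(1/4, 3; 2) × ]-2², 0[` and every
`K ≥ 𝒜₂(V, P)` (`SereginSverak2009.szEnergy`), `|V| ≤ Φ(K)` on `𝒞(1, 2; 1) × ]-1, 0[`, with one
non-decreasing `Φ` chosen before the solution. This file restates it for CLASSICAL axisymmetric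
solutions `(W, P)` of the unforced unit-viscosity system on `(-16, 0) × ℝ³`, with the data
bounded by the Albritton–Barker scaled sum `(A + C + D + E)(Q((0,0), 4))` on the ball cylinder
`Q((0,0),4) = (-16, 0) × B(0, 4) ⊇ Q̃`:

* the pressure is re-gauged by its ball mean, `P' = P - [P]_{B(0,4)}(t)` (a continuous function
  of time, `continuousOn_ballMean`), which does not affect suitability
  (`IsSuitableWeakSolutionOn.sub_pressure`) and turns the pressure term of `𝒜₂` into the
  mean-free quantity `D` of Albritton–Barker: `𝒜₂(W, P') ≤ 16 (A + C + D + E)(Q((0,0),4))`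
  (`szEnergy_sub_ballMean_le`);
* a classical solution is in the class of Prop. 4.1 on `Q̃` with `V = W` itself
  (`isSmoothAxisymmetricSolutionOn_of_classical`): classical ⇒ suitable
  (`isSuitableWeakSolutionOn_of_contDiffOn`), slices `C^∞`, and every spatial derivative
  `(t, x) ↦ D_xⁿ W(t, x)` is jointly `C¹` (it is the joint derivative composed with the
  embedding `x ↦ (0, x)`, `Literature.Analysis.Calculus.iteratedFDeriv_slice_right_eq`), hence
  locally Lipschitz (`exists_holderOnWith_iteratedFDeriv_slice`);
* `shellSupBound_of_abScaledSum`: `Ψ(K) = Φ(16 K)`.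

## References

* G. Seregin, W. Zajaczkowski, SIAM J. Math. Anal. 39 (2007) 669–685, Prop. 4.1.
  [SereginZajaczkowski2007]
* D. Albritton, T. Barker, J. Math. Fluid Mech. 21 (2019) = arXiv:1811.00502, §1 (the scaled
  quantities `A, C, D, E`). [AlbrittonBarker2019]
* L. Caffarelli, R. Kohn, L. Nirenberg, CPAM 35 (1982), §2 (the pressure is determined up to a
  function of time). [CaffarelliKohnNirenberg1982]
-/

noncomputable section

set_option linter.dupNamespace false -- nested layout Summit.<S>.<Sub>, Sub = S (D-0017)

open Set MeasureTheory Filter Topology Metric Function TopologicalSpace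
open scoped ENNReal NNReal ContDiff
open Literature.Analysis Literature.Analysis.FluidPDE
  Literature.Analysis.FluidPDE.SereginZajaczkowski2007 Literature.Analysis.FluidPDE.SereginSverak2009

namespace Summit.NavierStokesRegularity.NavierStokesRegularity.Theorems.BoundedEnvelope

/-! ### Geometry: the shell `Q̃` inside the ball cylinder `Q((0,0), 4)` -/

/-- A point of the spatial shell `𝒫²₁(0) = {1/4 < |x'| < 3, |x₃| < 2}` has norm `< 4`
(`|x|² = |x'|² + x₃² < 9 + 4 < 16`). [folklore] -/
theorem norm_lt_four_of_mem_outerShellSpace {x : EuclideanSpace ℝ (Fin 3)}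
    (hx : x ∈ outerShellSpace 1 0) : ‖x‖ < 4 := by
  rw [mem_outerShellSpace] at hx
  obtain ⟨⟨-, h1⟩, h2⟩ := hx
  rw [sub_zero] at h2
  have h3 := abs_lt.1 h2
  have hsq : ‖x‖ ^ 2 < 4 ^ 2 := by
    rw [norm_sq_eq_cylRadius_sq_add]
    nlinarith [cylRadius_nonneg x, h3.1, h3.2, h1]
  exact lt_of_pow_lt_pow_left₀ 2 (by norm_num) hsq

/-- `𝒫²₁(0) ⊆ B(0, 4)`. [folklore] -/
theorem outerShellSpace_one_subset_ball_four :
    outerShellSpace 1 0 ⊆ ball (0 : EuclideanSpace ℝ (Fin 3)) 4 := fun _ hx =>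
  mem_ball_zero_iff.2 (norm_lt_four_of_mem_outerShellSpace hx)

/-- `Q̃ = Q²₁(0) ⊆ Q((0, 0), 4) = ]-16, 0[ × B(0, 4)`. [folklore] -/
theorem outerShell_one_subset_parabolicCylinder_four :
    outerShell 1 0 ⊆ parabolicCylinder 4 ((0 : ℝ), (0 : EuclideanSpace ℝ (Fin 3))) := by
  intro z hz
  rw [mem_outerShell] at hz
  obtain ⟨⟨h1, h2⟩, hx⟩ := hz
  rw [mem_parabolicCylinder]
  refine ⟨⟨?_, h2⟩, ?_⟩
  · show (0 : ℝ) - 4 ^ 2 < z.1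
    linarith
  · show dist z.2 (0 : EuclideanSpace ℝ (Fin 3)) < 4
    rw [dist_zero_right]
    exact norm_lt_four_of_mem_outerShellSpace hx

/-- The times of `Q̃ = 𝒞(1/4, 3; 2) × ]-2², 0[` lie in `]-16, 0[`. [folklore] -/
theorem fst_mem_Ioo_of_mem_shellCyl_tilde {z : ℝ × EuclideanSpace ℝ (Fin 3)}
    (hz : z ∈ shellCyl (1 / 4) 3 2 2) : z.1 ∈ Ioo (-16 : ℝ) 0 := by
  rw [mem_shellCyl] at hz
  exact ⟨by linarith [hz.1.1], hz.1.2⟩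

/-- `Q̃ ⊆ ]-16, 0[ × ℝ³`. [folklore] -/
theorem shellCyl_tilde_subset_slab :
    ((shellCylOpens (1 / 4) 3 2 2 : Opens (ℝ × EuclideanSpace ℝ (Fin 3))) :
        Set (ℝ × EuclideanSpace ℝ (Fin 3))) ⊆ Ioo (-16 : ℝ) 0 ×ˢ univ :=
  fun _ hz => ⟨fst_mem_Ioo_of_mem_shellCyl_tilde hz, mem_univ _⟩

/-! ### `𝒜₂ ≤ 16 (A + C + D + E)(Q((0,0), 4))` for the re-gauged pressure -/

/-- `X ≤ 16 · (4⁻¹ X)` in `ℝ≥0∞`. [folklore] -/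
theorem le_sixteen_mul_inv_four_mul (X : ℝ≥0∞) : X ≤ 16 * ((ENNReal.ofReal 4)⁻¹ * X) := by
  rw [ENNReal.ofReal_ofNat, ← mul_assoc]
  have h : (16 : ℝ≥0∞) * 4⁻¹ = 4 := by
    rw [show (16 : ℝ≥0∞) = 4 * 4 by norm_num, mul_assoc,
      ENNReal.mul_inv_cancel (by norm_num) (by simp), mul_one]
  rw [h]
  calc X = 1 * X := (one_mul X).symm
    _ ≤ 4 * X := by gcongr; norm_num

/-- `X ≤ 16 · ((4²)⁻¹ X)` in `ℝ≥0∞`. [folklore] -/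
theorem le_sixteen_mul_inv_sq_four_mul (X : ℝ≥0∞) :
    X ≤ 16 * ((ENNReal.ofReal 4 ^ 2)⁻¹ * X) := by
  rw [ENNReal.ofReal_ofNat, ← mul_assoc]
  have h16 : (4 : ℝ≥0∞) ^ 2 = 16 := by norm_num
  rw [h16, ENNReal.mul_inv_cancel (by norm_num) (by simp), one_mul]

/-- **`𝒜₂(u, p - [p]_{B(0,4)}) ≤ 16 (A + C + D + E)(Q((0,0),4); u, p)`**: the shell
`Q̃ = Q²₁(0)` lies in the ball cylinder `Q((0,0), 4)`, `𝒫²₁(0) ⊆ B(0,4)`, `]-2², 0[ ⊆ ]-4², 0[`,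
the functionals at radius `4` carry the factors `4⁻¹, 4⁻², 4⁻², 4⁻¹`, and the pressure term of
`𝒜₂` for the re-gauged pressure is the mean-free quantity `D` of Albritton–Barker
(Seregin–Zajaczkowski 2007, §5: `Ã_{2R} ≤ c(A + E + C + D)`).
[cite: SereginZajaczkowski2007, §5 (the display Ã_{2R} ≤ c(A+E+C+D))] -/
theorem szEnergy_sub_ballMean_le
    (u : ℝ → EuclideanSpace ℝ (Fin 3) → EuclideanSpace ℝ (Fin 3))
    (p : ℝ → EuclideanSpace ℝ (Fin 3) → ℝ)
    (G : ℝ → EuclideanSpace ℝ (Fin 3) → EuclideanSpace ℝ (Fin 3) →L[ℝ] EuclideanSpace ℝ (Fin 3)) :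
    szEnergy u (fun t x => p t x - ⨍ y in ball (0 : EuclideanSpace ℝ (Fin 3)) 4, p t y) G ≤
      16 * abScaledSum 4 ((0 : ℝ), (0 : EuclideanSpace ℝ (Fin 3))) u p G := by
  have hsub := outerShell_one_subset_parabolicCylinder_four
  have hA : essSup (fun s : ℝ => ∫⁻ y in outerShellSpace 1 0, ‖u s y‖ₑ ^ 2)
      (volume.restrict (Ioo (-2 ^ 2) 0)) ≤
      16 * cknAEss 4 ((0 : ℝ), (0 : EuclideanSpace ℝ (Fin 3))) u := by
    have e : cknAEss 4 ((0 : ℝ), (0 : EuclideanSpace ℝ (Fin 3))) u =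
        essSup (fun t : ℝ => (ENNReal.ofReal 4)⁻¹ *
          ∫⁻ x in ball (0 : EuclideanSpace ℝ (Fin 3)) 4, ‖u t x‖ₑ ^ 2)
          (volume.restrict (Ioo ((0 : ℝ) - 4 ^ 2) 0)) := rfl
    rw [e, ← ENNReal.essSup_const_mul]
    have hmeas : volume.restrict (Ioo (-2 ^ 2 : ℝ) 0) ≤
        volume.restrict (Ioo ((0 : ℝ) - 4 ^ 2) 0) :=
      Measure.restrict_mono_set _ (Ioo_subset_Ioo (by norm_num) le_rfl)
    refine (essSup_mono_measure (Measure.absolutelyContinuous_of_le hmeas)).trans ?_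
    refine essSup_mono_ae (Eventually.of_forall fun s => ?_)
    exact (lintegral_mono_set outerShellSpace_one_subset_ball_four).trans
      (le_sixteen_mul_inv_four_mul _)
  have hE : ∫⁻ z in outerShell 1 0, ENNReal.ofReal (frobeniusNormSq (G z.1 z.2)) ≤
      16 * cknE 4 ((0 : ℝ), (0 : EuclideanSpace ℝ (Fin 3))) G :=
    (lintegral_mono_set hsub).trans (le_sixteen_mul_inv_four_mul _)
  have hC : ∫⁻ z in outerShell 1 0, ‖u z.1 z.2‖ₑ ^ (3 : ℕ) ≤
      16 * cknC 4 ((0 : ℝ), (0 : EuclideanSpace ℝ (Fin 3))) u :=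
    (lintegral_mono_set hsub).trans (le_sixteen_mul_inv_sq_four_mul _)
  have hD : ∫⁻ z in outerShell 1 0,
      ‖p z.1 z.2 - ⨍ y in ball (0 : EuclideanSpace ℝ (Fin 3)) 4, p z.1 y‖ₑ ^ (3 / 2 : ℝ) ≤
      16 * cknDOsc 4 ((0 : ℝ), (0 : EuclideanSpace ℝ (Fin 3))) p :=
    (lintegral_mono_set hsub).trans (le_sixteen_mul_inv_sq_four_mul _)
  unfold szEnergy abScaledSum
  calc _ ≤ 16 * cknAEss 4 ((0 : ℝ), (0 : EuclideanSpace ℝ (Fin 3))) u +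
        16 * cknE 4 ((0 : ℝ), (0 : EuclideanSpace ℝ (Fin 3))) G +
        16 * cknC 4 ((0 : ℝ), (0 : EuclideanSpace ℝ (Fin 3))) u +
        16 * cknDOsc 4 ((0 : ℝ), (0 : EuclideanSpace ℝ (Fin 3))) p :=
      add_le_add (add_le_add (add_le_add hA hE) hC) hD
    _ = _ := by ring

/-! ### The ball mean of a jointly continuous pressure is continuous in time -/

/-- **Continuity in time of the ball mean of a jointly continuous function**: if `q` is
continuous on `I × ℝ³` (`I` open), then `t ↦ ⨍_{B(0,R)} q(t, y) dy` is continuous on `I`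
(dominated convergence on a compact time neighbourhood). [folklore] -/
theorem continuousOn_ballMean {I : Set ℝ} (hI : IsOpen I)
    {q : ℝ → EuclideanSpace ℝ (Fin 3) → ℝ}
    (hq : ContinuousOn (uncurry q) (I ×ˢ (univ : Set (EuclideanSpace ℝ (Fin 3))))) (R : ℝ) :
    ContinuousOn (fun t => ⨍ y in ball (0 : EuclideanSpace ℝ (Fin 3)) R, q t y) I := by
  have e : (fun t => ⨍ y in ball (0 : EuclideanSpace ℝ (Fin 3)) R, q t y) =
      fun t => (volume.real (ball (0 : EuclideanSpace ℝ (Fin 3)) R))⁻¹ *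
        ∫ y in ball (0 : EuclideanSpace ℝ (Fin 3)) R, q t y := by
    funext t
    rw [setAverage_eq, smul_eq_mul]
  rw [e]
  refine continuousOn_const.mul ?_
  intro t₁ ht₁
  -- a compact time neighbourhood `[t₁ - ε/2, t₁ + ε/2] ⊆ I`
  obtain ⟨ε, hε, hεI⟩ := Metric.isOpen_iff.1 hI t₁ ht₁
  have hIcc : Icc (t₁ - ε / 2) (t₁ + ε / 2) ⊆ I := by
    intro t ht
    refine hεI ?_
    rw [Real.ball_eq_Ioo]
    exact ⟨by linarith [ht.1], by linarith [ht.2]⟩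
  have hKc : IsCompact (Icc (t₁ - ε / 2) (t₁ + ε / 2) ×ˢ
      closedBall (0 : EuclideanSpace ℝ (Fin 3)) R) :=
    isCompact_Icc.prod (isCompact_closedBall 0 R)
  obtain ⟨M, hM⟩ := hKc.exists_bound_of_continuousOn
    (hq.mono (prod_mono hIcc (subset_univ _)))
  have hnhds : Icc (t₁ - ε / 2) (t₁ + ε / 2) ∈ 𝓝[I] t₁ :=
    mem_nhdsWithin_of_mem_nhds (Icc_mem_nhds (by linarith) (by linarith))
  refine continuousWithinAt_of_dominated (bound := fun _ => M) ?_ ?_ ?_ ?_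
  · filter_upwards [hnhds] with t ht
    exact ((hq.comp (Continuous.prodMk_right t).continuousOn
      (fun y _ => ⟨hIcc ht, mem_univ y⟩)).mono (subset_univ _)).aestronglyMeasurable
      measurableSet_ball
  · filter_upwards [hnhds] with t ht
    refine (ae_restrict_mem measurableSet_ball).mono fun y hy => ?_
    exact hM (t, y) ⟨ht, ball_subset_closedBall hy⟩
  · exact integrableOn_const measure_ball_lt_top.ne
  · refine (ae_restrict_mem measurableSet_ball).mono fun y _ => ?_
    have h1 : ContinuousAt (uncurry q) (t₁, y) :=
      hq.continuousAt ((hI.prod isOpen_univ).mem_nhds ⟨ht₁, mem_univ y⟩)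
    have h2 : ContinuousAt (fun t : ℝ => (t, y)) t₁ :=
      (continuous_id.prodMk continuous_const).continuousAt
    exact (ContinuousAt.comp (f := fun t : ℝ => (t, y)) h1 h2).continuousWithinAt

/-! ### Classical solutions are in the class of Proposition 4.1 -/

/-- **Spatial derivatives of a jointly smooth field are locally Lipschitz in space–time.** If
`W` is jointly `C^∞` on `I × ℝ³` (`I` open), then for every order `n` and every point `z` with
`z.1 ∈ I` the map `(t, x) ↦ D_xⁿ W(t, x)` is Hölder continuous with exponent `1` on a
neighbourhood of `z` (intersected with any set `S`): by
`Literature.Analysis.Calculus.iteratedFDeriv_slice_right_eq` it is the joint `n`-th derivative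
composed with the embedding `x ↦ (0, x)`, a `C¹` map, hence locally Lipschitz. [folklore] -/
theorem exists_holderOnWith_iteratedFDeriv_slice {I : Set ℝ} (hI : IsOpen I)
    {W : ℝ → EuclideanSpace ℝ (Fin 3) → EuclideanSpace ℝ (Fin 3)}
    (hW : ContDiffOn ℝ ∞ (uncurry W) (I ×ˢ (univ : Set (EuclideanSpace ℝ (Fin 3)))))
    (n : ℕ) {z : ℝ × EuclideanSpace ℝ (Fin 3)} (hz : z.1 ∈ I)
    (S : Set (ℝ × EuclideanSpace ℝ (Fin 3))) :
    ∃ U ∈ 𝓝 z, ∃ C r : ℝ≥0, 0 < r ∧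
      HolderOnWith C r (fun w : ℝ × EuclideanSpace ℝ (Fin 3) => iteratedFDeriv ℝ n (W w.1) w.2)
        (U ∩ S) := by
  have hO : IsOpen (I ×ˢ (univ : Set (EuclideanSpace ℝ (Fin 3)))) := hI.prod isOpen_univ
  have hzO : z ∈ I ×ˢ (univ : Set (EuclideanSpace ℝ (Fin 3))) := ⟨hz, mem_univ _⟩
  set L := ContinuousMultilinearMap.compContinuousLinearMapL (𝕜 := ℝ) (ι := Fin n)
    (E := fun _ => EuclideanSpace ℝ (Fin 3)) (E₁ := fun _ => ℝ × EuclideanSpace ℝ (Fin 3))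
    (F := EuclideanSpace ℝ (Fin 3))
    (fun _ => ContinuousLinearMap.inr ℝ ℝ (EuclideanSpace ℝ (Fin 3))) with hL
  have heq : (fun w : ℝ × EuclideanSpace ℝ (Fin 3) => iteratedFDeriv ℝ n (W w.1) w.2) =ᶠ[𝓝 z]
      fun w => L (iteratedFDeriv ℝ n (uncurry W) w) := by
    filter_upwards [hO.mem_nhds hzO] with w hw
    rw [hL, ContinuousMultilinearMap.compContinuousLinearMapL_apply]
    exact Literature.Analysis.Calculus.iteratedFDeriv_slice_right_eq hI hW hw.1
      (by exact_mod_cast le_top) w.2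
  have hle : (1 : WithTop ℕ∞) + (n : ℕ) ≤ ((⊤ : ℕ∞) : WithTop ℕ∞) := by exact_mod_cast le_top
  have h1 : ContDiffAt ℝ 1 (fun w => L (iteratedFDeriv ℝ n (uncurry W) w)) z :=
    ((hW.contDiffAt (hO.mem_nhds hzO)).iteratedFDeriv_right (i := n) (m := 1)
      hle).continuousLinearMap_comp L
  have h2 : ContDiffAt ℝ 1
      (fun w : ℝ × EuclideanSpace ℝ (Fin 3) => iteratedFDeriv ℝ n (W w.1) w.2) z :=
    h1.congr_of_eventuallyEq heq
  obtain ⟨K, t, ht, hK⟩ := h2.exists_lipschitzOnWith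
  exact ⟨t, ht, K, 1, one_pos, (hK.mono inter_subset_left).holderOnWith⟩

/-- **A classical solution on `]-16, 0[ × ℝ³` is a suitable weak solution on `Q̃` after
re-gauging the pressure by its ball mean.** `(W, P)` is suitable on `Q̃ ⊆ ]-16,0[ × ℝ³`
(classical ⇒ suitable, `isSuitableWeakSolutionOn_of_contDiffOn`, Caffarelli–Kohn–Nirenberg 1982,
§2), and subtracting the continuous function of time `[P]_{B(0,4)}(t)` keeps it suitable
(`IsSuitableWeakSolutionOn.sub_pressure`). [cite: CaffarelliKohnNirenberg1982, §2 (2.1)–(2.5)] -/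
theorem isSuitableWeakSolutionOn_shell_of_classical
    {W : ℝ → EuclideanSpace ℝ (Fin 3) → EuclideanSpace ℝ (Fin 3)}
    {P : ℝ → EuclideanSpace ℝ (Fin 3) → ℝ}
    (hcl : IsClassicalNSSolutionOn (Ioo (-16 : ℝ) 0) 1 0 W P) :
    IsSuitableWeakSolutionOn (shellCylOpens (1 / 4) 3 2 2) 1 0 W
      (fun t x => P t x - ⨍ y in ball (0 : EuclideanSpace ℝ (Fin 3)) 4, P t y) := by
  have hQ := shellCyl_tilde_subset_slab
  have hsw : IsSuitableWeakSolutionOn (shellCylOpens (1 / 4) 3 2 2) 1 0 W P := by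
    refine isSuitableWeakSolutionOn_of_contDiffOn isOpen_Ioo hQ
      (hcl.smooth_velocity.of_le (by norm_cast)) (hcl.smooth_pressure.of_le (by norm_cast))
      continuousOn_const (fun t ht x => ?_) hcl.divFree
    have hmom := hcl.momentum t ht x
    rwa [timeDerivWithin_apply, derivWithin_of_isOpen isOpen_Ioo ht, ← timeDeriv_apply] at hmom
  have hc : ContinuousOn (fun t => ⨍ y in ball (0 : EuclideanSpace ℝ (Fin 3)) 4, P t y)
      (Ioo (-16 : ℝ) 0) :=
    continuousOn_ballMean isOpen_Ioo hcl.smooth_pressure.continuousOn 4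
  have hc2 : ContinuousOn
      (fun z : ℝ × EuclideanSpace ℝ (Fin 3) => ⨍ y in ball (0 : EuclideanSpace ℝ (Fin 3)) 4, P z.1 y)
      ((shellCylOpens (1 / 4) 3 2 2 : Opens (ℝ × EuclideanSpace ℝ (Fin 3))) :
        Set (ℝ × EuclideanSpace ℝ (Fin 3))) :=
    hc.comp continuous_fst.continuousOn fun z hz => (hQ hz).1
  refine hsw.sub_pressure (hc2.locallyIntegrableOn (measurableSet_shellCyl _ _ _ _))
    fun K hK hKc => ?_
  obtain ⟨M, hM⟩ := hKc.exists_bound_of_continuousOn (hc2.mono hK)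
  have hle : ∀ z ∈ K, ‖⨍ y in ball (0 : EuclideanSpace ℝ (Fin 3)) 4, P z.1 y‖ₑ ^ (3 / 2 : ℝ) ≤
      ENNReal.ofReal M ^ (3 / 2 : ℝ) := by
    intro z hz
    refine ENNReal.rpow_le_rpow ?_ (by norm_num)
    rw [← ofReal_norm]
    exact ENNReal.ofReal_le_ofReal (hM z hz)
  calc ∫⁻ z in K, ‖⨍ y in ball (0 : EuclideanSpace ℝ (Fin 3)) 4, P z.1 y‖ₑ ^ (3 / 2 : ℝ)
      ≤ ∫⁻ _ in K, ENNReal.ofReal M ^ (3 / 2 : ℝ) :=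
        setLIntegral_mono measurable_const fun z hz => hle z hz
    _ = ENNReal.ofReal M ^ (3 / 2 : ℝ) * volume K := setLIntegral_const _ _
    _ < ⊤ := ENNReal.mul_lt_top (ENNReal.rpow_lt_top_of_nonneg
        (by norm_num : (0 : ℝ) ≤ 3 / 2) ENNReal.ofReal_ne_top) hKc.measure_lt_top

/-- **A classical axisymmetric solution on `]-16, 0[ × ℝ³` is a "sufficiently smooth axially
symmetric solution" on `Q̃` in the sense of Seregin–Zajaczkowski 2007, Prop. 4.1** (with the
pressure re-gauged by its ball mean): suitable (`isSuitableWeakSolutionOn_shell_of_classical`),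
axisymmetric at the points of `Q̃` (the slices are), every slice `C^∞`, and all spatial
derivatives locally Lipschitz in space–time (`exists_holderOnWith_iteratedFDeriv_slice`).
[cite: SereginZajaczkowski2007, Prop. 4.1 (hypotheses) with §5 (the class it is applied to)] -/
theorem isSmoothAxisymmetricSolutionOn_of_classical
    {W : ℝ → EuclideanSpace ℝ (Fin 3) → EuclideanSpace ℝ (Fin 3)}
    {P : ℝ → EuclideanSpace ℝ (Fin 3) → ℝ}
    (hcl : IsClassicalNSSolutionOn (Ioo (-16 : ℝ) 0) 1 0 W P)
    (hax : ∀ t ∈ Ioo (-16 : ℝ) 0, IsAxisymmetric (W t)) :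
    IsSmoothAxisymmetricSolutionOn (shellCylOpens (1 / 4) 3 2 2) W
      (fun t x => P t x - ⨍ y in ball (0 : EuclideanSpace ℝ (Fin 3)) 4, P t y) where
  suitable := isSuitableWeakSolutionOn_shell_of_classical hcl
  axisymmetric :=
    isAxisymmetricOn_of_isAxisymmetric hax fun _ hz => fst_mem_Ioo_of_mem_shellCyl_tilde hz
  contDiffAt _ hz := (hcl.contDiff_velocity (fst_mem_Ioo_of_mem_shellCyl_tilde hz)).contDiffAt
  holder n _ hz := exists_holderOnWith_iteratedFDeriv_slice isOpen_Ioo hcl.smooth_velocity n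
    (fst_mem_Ioo_of_mem_shellCyl_tilde hz) _

/-! ### The stub -/

/-- **Stub AX1s of the axisymmetric support skeleton of the crux `BoundedEnvelopeContinuation`:
the single-shell sup bound (Seregin–Zajaczkowski 2007, Prop. 4.1) for classical axisymmetric
solutions, with the data bounded by the Albritton–Barker scaled sum on `Q((0,0), 4)`.** There is
a non-decreasing `Ψ : ℝ≥0 → ℝ≥0` such that for every classical solution `(W, P)` of the unforced
unit-viscosity Navier–Stokes system on `]-16, 0[ × ℝ³` with axisymmetric slices and every
`K ≥ (A + C + D + E)(Q((0,0),4); W, P, ∇W)`, `|W| ≤ Ψ(K)` on `𝒞(1, 2; 1) × ]-1, 0[`. Proof: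
`Ψ(K) = Φ(16 K)` with `Φ` from `OffAxisSupBound_holds`, applied to the pair `(W, P - [P]_{B(0,4)})`
(`isSmoothAxisymmetricSolutionOn_of_classical`, `szEnergy_sub_ballMean_le`).
[cite: SereginZajaczkowski2007, Prop. 4.1 ((4.1))] -/
theorem shellSupBound_of_abScaledSum : ∃ Ψ : ℝ≥0 → ℝ≥0, Monotone Ψ ∧ ∀ (W : ℝ → EuclideanSpace ℝ (Fin 3) → EuclideanSpace ℝ (Fin 3)) (P : ℝ → EuclideanSpace ℝ (Fin 3) → ℝ), Literature.Analysis.FluidPDE.IsClassicalNSSolutionOn (Set.Ioo (-16) 0) 1 0 W P → (∀ t ∈ Set.Ioo (-16 : ℝ) 0, Literature.Analysis.FluidPDE.IsAxisymmetric (W t)) → ∀ K : ℝ≥0, Literature.Analysis.FluidPDE.abScaledSum 4 ((0 : ℝ), (0 : EuclideanSpace ℝ (Fin 3))) W P (fun t x => fderiv ℝ (W t) x) ≤ K → ∀ z ∈ Literature.Analysis.FluidPDE.SereginZajaczkowski2007.shellCyl 1 2 1 1, ‖W z.1 z.2‖ ≤ Ψ K := by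
  obtain ⟨Φ, hΦm, hΦ⟩ := OffAxisSupBound_holds
  refine ⟨fun K => Φ (16 * K), fun a b hab => hΦm (by gcongr), ?_⟩
  intro W P hcl hax K hK z hz
  have hcls := isSmoothAxisymmetricSolutionOn_of_classical hcl hax
  have hE : szEnergy W (fun t x => P t x - ⨍ y in ball (0 : EuclideanSpace ℝ (Fin 3)) 4, P t y)
      (fun t x => fderiv ℝ (W t) x) ≤ ((16 * K : ℝ≥0) : ℝ≥0∞) :=
    calc _ ≤ 16 * abScaledSum 4 ((0 : ℝ), (0 : EuclideanSpace ℝ (Fin 3))) W P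
          (fun t x => fderiv ℝ (W t) x) := szEnergy_sub_ballMean_le _ _ _
      _ ≤ 16 * (K : ℝ≥0∞) := by gcongr
      _ = ((16 * K : ℝ≥0) : ℝ≥0∞) := by push_cast; rfl
  have key := hΦ W _ hcls (16 * K) hE z hz
  show ‖W z.1 z.2‖ ≤ (Φ (16 * K) : ℝ)
  exact le_trans (le_add_of_nonneg_right (Real.sqrt_nonneg _)) key

end Summit.NavierStokesRegularity.NavierStokesRegularity.Theorems.BoundedEnvelope

end
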